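import Literature.NumberTheory.Automorphic.UnitaryGroupTruncatedTracePolynomialOffBorel
import Literature.NumberTheory.Automorphic.UnitaryGroupTruncatedTraceClassPolynomialHoldsTwo
import Literature.NumberTheory.Automorphic.UnitaryGroupTruncatedTraceClassExpansionTwo
import HarnessLib

/-!
# LAW 3 of `U(J₂)` in closed form: `J^T(f) = Σ_{𝔬 ∈ S_f} p_𝔬(log T)`, `J(f) = Σ_{𝔬 ∈ S_f} p_𝔬(0)`, and the split at `B(F)`
# (the `N = 2` twin of the CM closers of ★ `UnitaryGroupTruncatedTracePolynomialExpansion` and ★ `…PolynomialOffBorel`)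

(Arthur, *The trace formula in invariant form*, Ann. of Math. 114 (1981), §2, Prop. 2.3: each `J^T_𝔬(f)` is a
polynomial in `T` and `J_𝔬(f)` is its constant term; Shokranian, *The Selberg–Arthur trace formula*, LNM 1503
(1992), Ch. 5, §5.2, Thm. (5.7) and Remark (5.8); Rogawski (1990), §2.2–2.3 pp. 13–14 and p. 98 «Let `G = U(3)`,
`U(2)`, or `U(2) × U(1)`».)

Topic `NumberTheory/Automorphic`; namespace `Literature.NumberTheory.Automorphic.UnitaryGroup`. THEOREMS ONLY over
accepted tree modules: no definition, no named fact, no instance, no notation, no `sorry`. H-side copy of LAWS 1–5 for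
the endoscopic group `H = U(Φ₂) × U(Φ₁)` of the line `Cruxes/H413/Lines/F0_T1InnerFormTraceIdentity.lean` (cell
hodgecm-mathlib, crux H413; census `CENSUS-LAWS-Hside` §3 LAW 3 «`TruncatedTracePolynomialExpansion∕OffBorel` `c 2`
corollaries»). The GENERIC §§ of the two ★ `N = 3` modules (`isTruncatedTracePolynomial_sum_of_forall_truncatedTraceClass_eq_eval`,
`arthurTrace_eq_sum_eval_zero_of_forall_truncatedTraceClass_eq_eval`, `classPolynomial_eq_C_of_forall_ne`, …) are
every-`N` and served by name; only their CM closers are `3`-typed, and this file re-types those three for `U(J₂)`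
(★ `quasiSplit L⁺ L c 2`), proofs verbatim, over the `N = 2` class spine ★ `truncatedTraceClassPolynomial_two_cm`
(★ `UnitaryGroupTruncatedTraceClassPolynomialHoldsTwo`) and ★ `truncatedTrace_eq_sum_truncatedTraceClass_charpoly_two_cm`
(★ `UnitaryGroupTruncatedTraceClassExpansionTwo`). Class map `charpoly ∘ adelicVal` (★ `isConjInvariant_charpoly_adelicVal`,
★ `isUnipotentInvariantOnBorel_charpoly_adelicVal`, every `N`); NO hypothesis beyond the letters.

* §1 **`truncatedTrace_eq_sum_eval_classPolynomial_charpoly_cm_two`** — `J^T(f) = Σ_{𝔬 ∈ S_f} p_𝔬(log T)` above a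
  threshold, all `p_𝔬` of degree `≤ 1`; **`arthurTrace_eq_sum_classPolynomial_eval_zero_charpoly_cm_two`** —
  `Σ p_𝔬` IS Arthur's polynomial and `J(f) = Σ_{𝔬 ∈ S_f} p_𝔬(0)`.
* §2 **`arthurTrace_eq_sum_offBorel_add_sum_charpoly_cm_two`** —
  `J(f) = Σ_{𝔬 ∈ S_f, 𝔬 ∩ B(F) = ∅} J^T_𝔬(f) + Σ_{𝔬 ∈ S_f, 𝔬 ∩ B(F) ≠ ∅} p_𝔬(0)` for every `T` (the classes missing
  `B(F)` have CONSTANT class polynomial, ★ `classPolynomial_eq_C_of_forall_ne`) — the socket into which the LAW-4 fold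
  `UnitaryGroupArthurTraceEllipticOrbitalTwo` plugs the orbital integrals class by class.

## References

* J. Arthur, *The trace formula in invariant form*, Ann. of Math. 114 (1981), §2, Prop. 2.3
  [Arthur1981TraceFormulaInvariantForm].
* S. Shokranian, *The Selberg–Arthur trace formula*, LNM 1503 (1992), Ch. 5, §5.2, Thm. (5.7), Remark (5.8)
  [Shokranian1992].
* J. D. Rogawski, *Automorphic Representations of Unitary Groups in Three Variables*, Ann. of Math. Stud. 123
  (1990), §2.2–2.3 (pp. 13–14), §7.3 (p. 98) [Rogawski1990].
-/

set_option autoImplicit false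

noncomputable section

open MeasureTheory Measure NumberField NumberField.mixedEmbedding IsDedekindDomain Set Polynomial
open scoped NNReal ENNReal Pointwise MatrixGroups Classical

namespace Literature.NumberTheory.Automorphic

namespace UnitaryGroup

/-! ## §1 The CM closers at `N = 2`: `J^T(f) = Σ_{𝔬 ∈ S_f} p_𝔬(log T)` and `J(f) = Σ_{𝔬 ∈ S_f} p_𝔬(0)` -/

/-- **LAW 3 of `U(J₂)`, closed form at a CM extension `L/L⁺`** (quasi-split `U(J₂)`, class map `charpoly ∘ adelicVal`,
NO hypothesis): for every Haar measure `ν` of `N(𝔸)`, fundamental domain `𝓕` of `N(L⁺)`, automorphic measure `μ`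
and test function `f` there are a FINITE set `S_f` of classes, class polynomials `p_𝔬 ∈ ℂ[X]` ALL of degree
`≤ 1`, and a threshold `T₀` with, for all `T > T₀`: `J^T_𝔬(f) = p_𝔬(log T)` for every `𝔬 ∈ S_f`, and
**`J^T(f) = Σ_{𝔬 ∈ S_f} p_𝔬(log T)`**. (★ `truncatedTrace_eq_sum_truncatedTraceClass_charpoly_two_cm` ∘ ★
`truncatedTraceClassPolynomial_two_cm`, thresholds maxed over `S_f`.) [cite: Rogawski1990, §2.2 (p. 13)]
[cite: Arthur1981TraceFormulaInvariantForm, Prop. 2.3] [cite: Shokranian1992, Thm. (5.7) and Rem. (5.8)] -/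
theorem truncatedTrace_eq_sum_eval_classPolynomial_charpoly_cm_two (L : Type) [Field L] [NumberField L] [IsCMField L] :
    ∀ [MeasurableSpace (adelicUnipotent (↥(maximalRealSubfield L)) L (IsCMField.complexConj L) 2)]
      [BorelSpace (adelicUnipotent (↥(maximalRealSubfield L)) L (IsCMField.complexConj L) 2)]
      (ν : Measure (adelicUnipotent (↥(maximalRealSubfield L)) L (IsCMField.complexConj L) 2)) [ν.IsHaarMeasure]
      (𝓕 : Set (adelicUnipotent (↥(maximalRealSubfield L)) L (IsCMField.complexConj L) 2)),
      IsFundamentalDomain (rationalUnipotent (↥(maximalRealSubfield L)) L (IsCMField.complexConj L) 2) 𝓕 ν →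
        ∀ (μ : Measure (quasiSplit (↥(maximalRealSubfield L)) L (IsCMField.complexConj L) 2).automorphicQuotient)
          [(quasiSplit (↥(maximalRealSubfield L)) L (IsCMField.complexConj L) 2).IsAutomorphicMeasure μ]
          (f : (quasiSplit (↥(maximalRealSubfield L)) L (IsCMField.complexConj L) 2).Adelic → ℂ),
          IsQuasiSplitTest (↥(maximalRealSubfield L)) L (IsCMField.complexConj L) 2 f →
          ∃ S : Finset (AdeleRing (𝓞 L) L)[X], ∃ P : (AdeleRing (𝓞 L) L)[X] → ℂ[X],
            (∀ i, (P i).natDegree ≤ 1) ∧ ∃ T₀ : ℝ≥0, ∀ T : ℝ≥0, T₀ < T →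
              (∀ i ∈ S, truncatedTraceClass μ ν 𝓕 T
                (fun γ : ↥(quasiSplit (↥(maximalRealSubfield L)) L (IsCMField.complexConj L) 2).arithmeticSubgroup =>
                  ((adelicVal (↥(maximalRealSubfield L)) L (IsCMField.complexConj L) 2 _ (γ : (quasiSplit (↥(maximalRealSubfield L)) L (IsCMField.complexConj L) 2).Adelic) :
                    GL (Fin 2) (AdeleRing (𝓞 L) L)) : Matrix (Fin 2) (Fin 2) (AdeleRing (𝓞 L) L)).charpoly) i f =
                  (P i).eval ((Real.log (T : ℝ) : ℝ) : ℂ)) ∧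
              truncatedTrace μ ν 𝓕 T f = ∑ i ∈ S, (P i).eval ((Real.log (T : ℝ) : ℝ) : ℂ) := by
  intro mN bN ν hν 𝓕 h𝓕 μ hμ f hf
  obtain ⟨S, T₁, hT₁⟩ := truncatedTrace_eq_sum_truncatedTraceClass_charpoly_two_cm L ν 𝓕 h𝓕 μ f hf
  have hP := fun i => truncatedTraceClassPolynomial_two_cm L
    (isConjInvariant_charpoly_adelicVal (F := ↥(maximalRealSubfield L)) (E := L) (c := IsCMField.complexConj L) (N := 2))
    (isUnipotentInvariantOnBorel_charpoly_adelicVal (F := ↥(maximalRealSubfield L)) (E := L) (c := IsCMField.complexConj L) (N := 2))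
    i ν 𝓕 h𝓕 μ f hf
  choose P hPdeg T₀ hT₀ using hP
  refine ⟨S, P, hPdeg, max T₁ (S.sup T₀), fun T hT => ?_⟩
  have h1 : ∀ i ∈ S, truncatedTraceClass μ ν 𝓕 T
      (fun γ : ↥(quasiSplit (↥(maximalRealSubfield L)) L (IsCMField.complexConj L) 2).arithmeticSubgroup =>
        ((adelicVal (↥(maximalRealSubfield L)) L (IsCMField.complexConj L) 2 _ (γ : (quasiSplit (↥(maximalRealSubfield L)) L (IsCMField.complexConj L) 2).Adelic) :
          GL (Fin 2) (AdeleRing (𝓞 L) L)) : Matrix (Fin 2) (Fin 2) (AdeleRing (𝓞 L) L)).charpoly) i f =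
        (P i).eval ((Real.log (T : ℝ) : ℝ) : ℂ) :=
    fun i hi => hT₀ i T (lt_of_le_of_lt ((Finset.le_sup hi).trans (le_max_right _ _)) hT)
  refine ⟨h1, ?_⟩
  rw [(hT₁ T (lt_of_le_of_lt (le_max_left _ _) hT)).2.2]
  exact Finset.sum_congr rfl h1

/-- **LAW 3 of `U(J₂)`, constant term at a CM extension `L/L⁺`** (NO hypothesis): with `S_f` and the class polynomials
`p_𝔬` (all of degree `≤ 1`, each computing `J^T_𝔬(f)` above a threshold) as above, `Σ_{𝔬 ∈ S_f} p_𝔬` computes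
`J^T(f)`, it IS Arthur's polynomial `truncatedTracePolynomial μ ν 𝓕 f` (degree `≤ 1`), and
**`J(f) = arthurTrace μ ν 𝓕 f = Σ_{𝔬 ∈ S_f} p_𝔬(0)`**. [cite: Rogawski1990, §2.2 (p. 13)]
[cite: Arthur1981TraceFormulaInvariantForm, Prop. 2.3] [cite: Shokranian1992, §5.2] -/
theorem arthurTrace_eq_sum_classPolynomial_eval_zero_charpoly_cm_two (L : Type) [Field L] [NumberField L]
    [IsCMField L] :
    ∀ [MeasurableSpace (adelicUnipotent (↥(maximalRealSubfield L)) L (IsCMField.complexConj L) 2)]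
      [BorelSpace (adelicUnipotent (↥(maximalRealSubfield L)) L (IsCMField.complexConj L) 2)]
      (ν : Measure (adelicUnipotent (↥(maximalRealSubfield L)) L (IsCMField.complexConj L) 2)) [ν.IsHaarMeasure]
      (𝓕 : Set (adelicUnipotent (↥(maximalRealSubfield L)) L (IsCMField.complexConj L) 2)),
      IsFundamentalDomain (rationalUnipotent (↥(maximalRealSubfield L)) L (IsCMField.complexConj L) 2) 𝓕 ν →
        ∀ (μ : Measure (quasiSplit (↥(maximalRealSubfield L)) L (IsCMField.complexConj L) 2).automorphicQuotient)
          [(quasiSplit (↥(maximalRealSubfield L)) L (IsCMField.complexConj L) 2).IsAutomorphicMeasure μ]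
          (f : (quasiSplit (↥(maximalRealSubfield L)) L (IsCMField.complexConj L) 2).Adelic → ℂ),
          IsQuasiSplitTest (↥(maximalRealSubfield L)) L (IsCMField.complexConj L) 2 f →
          ∃ S : Finset (AdeleRing (𝓞 L) L)[X], ∃ P : (AdeleRing (𝓞 L) L)[X] → ℂ[X],
            (∀ i, (P i).natDegree ≤ 1) ∧
            (∀ i ∈ S, ∃ T₀ : ℝ≥0, ∀ T : ℝ≥0, T₀ < T → truncatedTraceClass μ ν 𝓕 T
                (fun γ : ↥(quasiSplit (↥(maximalRealSubfield L)) L (IsCMField.complexConj L) 2).arithmeticSubgroup =>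
                  ((adelicVal (↥(maximalRealSubfield L)) L (IsCMField.complexConj L) 2 _ (γ : (quasiSplit (↥(maximalRealSubfield L)) L (IsCMField.complexConj L) 2).Adelic) :
                    GL (Fin 2) (AdeleRing (𝓞 L) L)) : Matrix (Fin 2) (Fin 2) (AdeleRing (𝓞 L) L)).charpoly) i f =
                  (P i).eval ((Real.log (T : ℝ) : ℝ) : ℂ)) ∧
            IsTruncatedTracePolynomial μ ν 𝓕 f (∑ i ∈ S, P i) ∧
            (∑ i ∈ S, P i).natDegree ≤ 1 ∧
            truncatedTracePolynomial μ ν 𝓕 f = ∑ i ∈ S, P i ∧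
            arthurTrace μ ν 𝓕 f = ∑ i ∈ S, (P i).eval 0 := by
  intro mN bN ν hν 𝓕 h𝓕 μ hμ f hf
  obtain ⟨S, P, hPdeg, T₀, hT₀⟩ := truncatedTrace_eq_sum_eval_classPolynomial_charpoly_cm_two L ν 𝓕 h𝓕 μ f hf
  -- `Σ_{𝔬 ∈ S} P 𝔬` computes `J^T(f)` directly from §2's closed form
  have hpoly : IsTruncatedTracePolynomial μ ν 𝓕 f (∑ i ∈ S, P i) :=
    ⟨T₀, fun T hT => by rw [(hT₀ T hT).2, eval_finsetSum]⟩
  exact ⟨S, P, hPdeg, fun i hi => ⟨T₀, fun T hT => (hT₀ T hT).1 i hi⟩, hpoly,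
    natDegree_sum_le_of_forall_le _ _ fun i _ => hPdeg i, truncatedTracePolynomial_eq hpoly,
    by rw [arthurTrace_eq_eval hpoly, eval_finsetSum]⟩

/-! ## §2 The CM closer split at `B(F)`, `N = 2`: `J(f) = Σ_{𝔬 off B(F)} J^T_𝔬(f) + Σ_{𝔬 meeting B(F)} p_𝔬(0)` -/

/-- **The constant term of the fine `𝔬`-expansion, split at `B(F)`, on the quasi-split `U(J₂)` of a CM extension
`L/L⁺`** (class map `charpoly ∘ adelicVal`, NO hypothesis): for every Haar measure `ν` of `N(𝔸)`, fundamental domain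
`𝓕` of `N(L⁺)`, automorphic measure `μ` and test function `f` there are the LAW-3 closer's finite set `S_f` of classes
and class polynomials `p_𝔬` (all of degree `≤ 1`, `p_𝔬` computing `J^T_𝔬(f)` above a threshold for `𝔬 ∈ S_f`,
`Σ_{𝔬 ∈ S_f} p_𝔬 =` Arthur's polynomial of `f`) such that every `p_𝔬` with `𝔬 ∈ S_f` missing `B(F)` is the constant
`C (J^T_𝔬(f))` (any `T`), and for EVERY `T`:
**`J(f) = Σ_{𝔬 ∈ S_f, 𝔬 ∩ B(F) = ∅} J^T_𝔬(f) + Σ_{𝔬 ∈ S_f, 𝔬 ∩ B(F) ≠ ∅} p_𝔬(0)`**. (The first sum is where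
the elliptic orbital integrals of Rogawski §2.3 enter, class by class, by `Finset.sum_congr`.)
[cite: Rogawski1990, §2.2–2.3 (pp. 13–14)] [cite: Arthur1981TraceFormulaInvariantForm, Prop. 2.3]
[cite: Shokranian1992, §5.2] -/
theorem arthurTrace_eq_sum_offBorel_add_sum_charpoly_cm_two (L : Type) [Field L] [NumberField L] [IsCMField L] :
    ∀ [MeasurableSpace (adelicUnipotent (↥(maximalRealSubfield L)) L (IsCMField.complexConj L) 2)]
      [BorelSpace (adelicUnipotent (↥(maximalRealSubfield L)) L (IsCMField.complexConj L) 2)]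
      (ν : Measure (adelicUnipotent (↥(maximalRealSubfield L)) L (IsCMField.complexConj L) 2)) [ν.IsHaarMeasure]
      (𝓕 : Set (adelicUnipotent (↥(maximalRealSubfield L)) L (IsCMField.complexConj L) 2)),
      IsFundamentalDomain (rationalUnipotent (↥(maximalRealSubfield L)) L (IsCMField.complexConj L) 2) 𝓕 ν →
        ∀ (μ : Measure (quasiSplit (↥(maximalRealSubfield L)) L (IsCMField.complexConj L) 2).automorphicQuotient)
          [(quasiSplit (↥(maximalRealSubfield L)) L (IsCMField.complexConj L) 2).IsAutomorphicMeasure μ]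
          (f : (quasiSplit (↥(maximalRealSubfield L)) L (IsCMField.complexConj L) 2).Adelic → ℂ),
          IsQuasiSplitTest (↥(maximalRealSubfield L)) L (IsCMField.complexConj L) 2 f →
          ∃ S : Finset (AdeleRing (𝓞 L) L)[X], ∃ P : (AdeleRing (𝓞 L) L)[X] → ℂ[X],
            (∀ i, (P i).natDegree ≤ 1) ∧
            (∀ i ∈ S, ∃ T₀ : ℝ≥0, ∀ T : ℝ≥0, T₀ < T → truncatedTraceClass μ ν 𝓕 T
                (fun γ : ↥(quasiSplit (↥(maximalRealSubfield L)) L (IsCMField.complexConj L) 2).arithmeticSubgroup =>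
                  ((adelicVal (↥(maximalRealSubfield L)) L (IsCMField.complexConj L) 2 _ (γ : (quasiSplit (↥(maximalRealSubfield L)) L (IsCMField.complexConj L) 2).Adelic) :
                    GL (Fin 2) (AdeleRing (𝓞 L) L)) : Matrix (Fin 2) (Fin 2) (AdeleRing (𝓞 L) L)).charpoly) i f =
                  (P i).eval ((Real.log (T : ℝ) : ℝ) : ℂ)) ∧
            truncatedTracePolynomial μ ν 𝓕 f = ∑ i ∈ S, P i ∧
            (∀ i ∈ S, (∀ β : arithmeticBorel (↥(maximalRealSubfield L)) L (IsCMField.complexConj L) 2,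
                (fun γ : ↥(quasiSplit (↥(maximalRealSubfield L)) L (IsCMField.complexConj L) 2).arithmeticSubgroup =>
                  ((adelicVal (↥(maximalRealSubfield L)) L (IsCMField.complexConj L) 2 _ (γ : (quasiSplit (↥(maximalRealSubfield L)) L (IsCMField.complexConj L) 2).Adelic) :
                    GL (Fin 2) (AdeleRing (𝓞 L) L)) : Matrix (Fin 2) (Fin 2) (AdeleRing (𝓞 L) L)).charpoly) β ≠ i) →
              ∀ T : ℝ≥0, P i = C (truncatedTraceClass μ ν 𝓕 T
                (fun γ : ↥(quasiSplit (↥(maximalRealSubfield L)) L (IsCMField.complexConj L) 2).arithmeticSubgroup =>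
                  ((adelicVal (↥(maximalRealSubfield L)) L (IsCMField.complexConj L) 2 _ (γ : (quasiSplit (↥(maximalRealSubfield L)) L (IsCMField.complexConj L) 2).Adelic) :
                    GL (Fin 2) (AdeleRing (𝓞 L) L)) : Matrix (Fin 2) (Fin 2) (AdeleRing (𝓞 L) L)).charpoly) i f)) ∧
            ∀ T : ℝ≥0, arthurTrace μ ν 𝓕 f =
              (∑ i ∈ S.filter (fun i => ∀ β : arithmeticBorel (↥(maximalRealSubfield L)) L (IsCMField.complexConj L) 2,
                (fun γ : ↥(quasiSplit (↥(maximalRealSubfield L)) L (IsCMField.complexConj L) 2).arithmeticSubgroup =>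
                  ((adelicVal (↥(maximalRealSubfield L)) L (IsCMField.complexConj L) 2 _ (γ : (quasiSplit (↥(maximalRealSubfield L)) L (IsCMField.complexConj L) 2).Adelic) :
                    GL (Fin 2) (AdeleRing (𝓞 L) L)) : Matrix (Fin 2) (Fin 2) (AdeleRing (𝓞 L) L)).charpoly) β ≠ i),
                truncatedTraceClass μ ν 𝓕 T
                  (fun γ : ↥(quasiSplit (↥(maximalRealSubfield L)) L (IsCMField.complexConj L) 2).arithmeticSubgroup =>
                    ((adelicVal (↥(maximalRealSubfield L)) L (IsCMField.complexConj L) 2 _ (γ : (quasiSplit (↥(maximalRealSubfield L)) L (IsCMField.complexConj L) 2).Adelic) :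
                      GL (Fin 2) (AdeleRing (𝓞 L) L)) : Matrix (Fin 2) (Fin 2) (AdeleRing (𝓞 L) L)).charpoly) i f) +
              ∑ i ∈ S.filter (fun i => ¬ ∀ β : arithmeticBorel (↥(maximalRealSubfield L)) L (IsCMField.complexConj L) 2,
                (fun γ : ↥(quasiSplit (↥(maximalRealSubfield L)) L (IsCMField.complexConj L) 2).arithmeticSubgroup =>
                  ((adelicVal (↥(maximalRealSubfield L)) L (IsCMField.complexConj L) 2 _ (γ : (quasiSplit (↥(maximalRealSubfield L)) L (IsCMField.complexConj L) 2).Adelic) :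
                    GL (Fin 2) (AdeleRing (𝓞 L) L)) : Matrix (Fin 2) (Fin 2) (AdeleRing (𝓞 L) L)).charpoly) β ≠ i),
                (P i).eval 0 := by
  intro mN bN ν hν 𝓕 h𝓕 μ hμ f hf
  obtain ⟨S, P, hPdeg, hP, -, -, hpoly, harthur⟩ :=
    arthurTrace_eq_sum_classPolynomial_eval_zero_charpoly_cm_two L ν 𝓕 h𝓕 μ f hf
  -- the off-`B(F)` class polynomials are constants
  have hC : ∀ i ∈ S, (∀ β : arithmeticBorel (↥(maximalRealSubfield L)) L (IsCMField.complexConj L) 2,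
      (fun γ : ↥(quasiSplit (↥(maximalRealSubfield L)) L (IsCMField.complexConj L) 2).arithmeticSubgroup =>
        ((adelicVal (↥(maximalRealSubfield L)) L (IsCMField.complexConj L) 2 _ (γ : (quasiSplit (↥(maximalRealSubfield L)) L (IsCMField.complexConj L) 2).Adelic) :
          GL (Fin 2) (AdeleRing (𝓞 L) L)) : Matrix (Fin 2) (Fin 2) (AdeleRing (𝓞 L) L)).charpoly) β ≠ i) →
      ∀ T : ℝ≥0, P i = C (truncatedTraceClass μ ν 𝓕 T
        (fun γ : ↥(quasiSplit (↥(maximalRealSubfield L)) L (IsCMField.complexConj L) 2).arithmeticSubgroup =>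
          ((adelicVal (↥(maximalRealSubfield L)) L (IsCMField.complexConj L) 2 _ (γ : (quasiSplit (↥(maximalRealSubfield L)) L (IsCMField.complexConj L) 2).Adelic) :
            GL (Fin 2) (AdeleRing (𝓞 L) L)) : Matrix (Fin 2) (Fin 2) (AdeleRing (𝓞 L) L)).charpoly) i f) := by
    intro i hi hiB T
    obtain ⟨T₀, hT₀⟩ := hP i hi
    exact classPolynomial_eq_C_of_forall_ne hiB hT₀ ν 𝓕 T
  refine ⟨S, P, hPdeg, hP, hpoly, hC, fun T => ?_⟩
  rw [harthur, ← Finset.sum_filter_add_sum_filter_not S (fun i =>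
    ∀ β : arithmeticBorel (↥(maximalRealSubfield L)) L (IsCMField.complexConj L) 2,
      (fun γ : ↥(quasiSplit (↥(maximalRealSubfield L)) L (IsCMField.complexConj L) 2).arithmeticSubgroup =>
        ((adelicVal (↥(maximalRealSubfield L)) L (IsCMField.complexConj L) 2 _ (γ : (quasiSplit (↥(maximalRealSubfield L)) L (IsCMField.complexConj L) 2).Adelic) :
          GL (Fin 2) (AdeleRing (𝓞 L) L)) : Matrix (Fin 2) (Fin 2) (AdeleRing (𝓞 L) L)).charpoly) β ≠ i)]
  congr 1
  refine Finset.sum_congr rfl fun i hi => ?_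
  rw [Finset.mem_filter] at hi
  rw [hC i hi.1 hi.2 T, eval_C]

end UnitaryGroup

end Literature.NumberTheory.Automorphic
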